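import Summits.Ventures.DiscreteObjects.STD.OrderFiveReduction

/-!
# STD₂[12;6]: no automorphism of order 7; the 'identity type' is impossible for every prime order p ≥ 3 (kernel; lemma P7)
Framing: lottery ticket; floor = certified bounds/negative ranges.

Cell pub-namedobj (target M), STD₂[12;6] automorphism census. Designs g5's paper lemma P7 (FAMILY-ZCOVER §9, refereed by
verify-ref g53) in the incidence-array vocabulary of `OrderFiveReduction`: an array automorphism `τ` of an STD₂[12;6] with
`σ⁷ = 1`, `ρ⁷ = 1` and `(β j)⁷ = 1` on every fixed block class is the identity on points (`no_order_seven`). Proof: a permutation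
of the 6 labels with seventh power 1 is the identity and `ρ` fixes 5 or 12 block classes, so two block classes are fixed blockwise;
if some point class moves, the orbit of one of its points (7 distinct classes) lies on the fixed block through it in both classes —
7 > 2 common points (`no_identity_type_prime`, stated for every prime `p ≥ 3` via `Function.IsPeriodicPt.gcd`); hence `σ = 1`, and
then every `α i` is conjugate to `β j = 1`. With designs g5/g6 (ZC-2, ZC-3, Z11, P5) this is the kernel part of
'|Aut(STD₂[12;6])| is a {2,3}-number' (orders 11 and 5 rest on exhaustive searches; 13 and larger primes fix all 12 classes and all
labels, `no_order_prime_ge_thirteen`).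
-/

namespace Summit.Ventures.DiscreteObjects.STD

open Finset Equiv Function Summit.Ventures.DiscreteObjects.PP12

section PermFacts

variable {n : ℕ}

/-- If `σᵖ = 1` (`p` prime) and `σᵈ y = y` for some `0 < d < p` then `σ y = y`. -/
theorem fixed_of_pow_fixed_prime {σ : Perm (Fin n)} {p : ℕ} (hp : p.Prime) (hσ : σ ^ p = 1) {d : ℕ} (hd0 : 0 < d)
    (hdp : d < p) {y : Fin n} (h : (σ ^ d) y = y) : σ y = y := by
  have h1 : IsPeriodicPt σ d y := by
    change (⇑σ)^[d] y = y
    rw [← Perm.coe_pow]; exact h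
  have h2 : IsPeriodicPt σ p y := by
    change (⇑σ)^[p] y = y
    rw [← Perm.coe_pow, hσ]; rfl
  have hg : d.gcd p = 1 := (Nat.coprime_of_lt_prime hd0.ne' hdp hp).symm
  have h3 := h1.gcd h2
  rw [hg] at h3
  have h4 : (⇑σ)^[1] y = y := h3
  rwa [Function.iterate_one] at h4

/-- If `σᵖ = 1` (`p` prime) and `σ i ≠ i`, the classes `σᵐ i`, `m < p`, are pairwise distinct. -/
theorem pow_apply_injective_prime {σ : Perm (Fin n)} {p : ℕ} (hp : p.Prime) (hσ : σ ^ p = 1) {i : Fin n}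
    (hi : σ i ≠ i) : Function.Injective fun m : Fin p => (σ ^ (m : ℕ)) i := by
  intro m m' hmm
  simp only at hmm
  by_contra hne
  rcases lt_or_gt_of_ne (fun h : (m : ℕ) = m' => hne (Fin.ext h)) with hlt | hlt
  · have hd : (σ ^ ((m' : ℕ) - m)) ((σ ^ (m : ℕ)) i) = (σ ^ (m : ℕ)) i := by
      rw [← Perm.mul_apply, ← pow_add, Nat.sub_add_cancel hlt.le, ← hmm]
    have hy := fixed_of_pow_fixed_prime hp hσ (Nat.sub_pos_of_lt hlt) (by omega) hd
    apply hi
    have : (σ ^ (m : ℕ)) (σ i) = (σ ^ (m : ℕ)) i := by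
      rw [← Perm.mul_apply, ← pow_succ, pow_succ', Perm.mul_apply, hy]
    exact (σ ^ (m : ℕ)).injective this
  · have hd : (σ ^ ((m : ℕ) - m')) ((σ ^ (m' : ℕ)) i) = (σ ^ (m' : ℕ)) i := by
      rw [← Perm.mul_apply, ← pow_add, Nat.sub_add_cancel hlt.le, hmm]
    have hy := fixed_of_pow_fixed_prime hp hσ (Nat.sub_pos_of_lt hlt) (by omega) hd
    apply hi
    have : (σ ^ (m' : ℕ)) (σ i) = (σ ^ (m' : ℕ)) i := by
      rw [← Perm.mul_apply, ← pow_succ, pow_succ', Perm.mul_apply, hy]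
    exact (σ ^ (m' : ℕ)).injective this

/-- A permutation of `Fin 6` whose seventh power is `1` is the identity. -/
theorem eq_one_of_pow_seven_six {α : Perm (Fin 6)} (hα : α ^ 7 = 1) : α = 1 := by
  haveI : Fact (Nat.Prime 7) := ⟨by norm_num⟩
  have h1 := fixedCard_modEq hα
  have h2 := fixedCard_le α
  simp only [Fintype.card_fin] at h1
  unfold Nat.ModEq at h1
  exact eq_one_of_fixedCard_eq α (by omega)

/-- A permutation of `Fin 12` whose seventh power is `1` fixes 5 or 12 points. -/
theorem fixedCard_twelve_of_pow_seven {σ : Perm (Fin 12)} (hσ : σ ^ 7 = 1) :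
    fixedCard σ = 5 ∨ fixedCard σ = 12 := by
  haveI : Fact (Nat.Prime 7) := ⟨by norm_num⟩
  have h1 := fixedCard_modEq hσ
  have h2 := fixedCard_le σ
  simp only [Fintype.card_fin] at h1
  unfold Nat.ModEq at h1
  omega

end PermFacts

section STD

variable (π : IncArray 12 6) (τ : ArrayAut π)

/-- **Identity type, any prime order `p ≥ 3`.** If `σᵖ = 1`, two distinct block classes are fixed by `ρ` with trivial label maps
and some point class is moved by `σ`, the STD₂ axioms fail: the `p`-orbit of a point lies on the two fixed blocks through it,
which then have `p > 2` common points. -/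
theorem no_identity_type_prime (hπ : IsSTD 2 π) {p : ℕ} (hp : p.Prime) (h3 : 3 ≤ p) (hσ : τ.σ ^ p = 1)
    {j₁ j₂ : Fin 12} (hj : j₁ ≠ j₂) (hj₁ : τ.ρ j₁ = j₁) (hj₂ : τ.ρ j₂ = j₂) (hb₁ : τ.β j₁ = 1) (hb₂ : τ.β j₂ = 1)
    {i : Fin 12} (hi : τ.σ i ≠ i) : False := by
  let aSeq : ℕ → Fin 6 := fun m => Nat.rec (0 : Fin 6) (fun m a => τ.α ((τ.σ ^ m) i) a) m
  have aSeq_succ : ∀ m, aSeq (m + 1) = τ.α ((τ.σ ^ m) i) (aSeq m) := fun m => rfl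
  have aSeq_zero : aSeq 0 = 0 := rfl
  have key : ∀ (j : Fin 12), τ.ρ j = j → τ.β j = 1 → ∀ m : ℕ, π ((τ.σ ^ m) i) j (aSeq m) = π i j 0 := by
    intro j hjf hbj m
    induction m with
    | zero => simp [aSeq_zero]
    | succ m ih =>
      rw [aSeq_succ, pow_succ', Perm.mul_apply]
      have h := τ.map_inc ((τ.σ ^ m) i) j (aSeq m)
      rw [hjf, hbj, ih] at h
      simpa using h
  have hcount := hπ.2 j₁ j₂ hj (π i j₁ 0) (π i j₂ 0)
  have hsub : (univ.image fun m : Fin p => (τ.σ ^ (m : ℕ)) i) ⊆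
      univ.filter (fun i' => (π i' j₁).symm (π i j₁ 0) = (π i' j₂).symm (π i j₂ 0)) := by
    intro i' hi'
    obtain ⟨m, -, rfl⟩ := mem_image.mp hi'
    simp only [mem_filter, mem_univ, true_and]
    rw [← key j₁ hj₁ hb₁ m, ← key j₂ hj₂ hb₂ m, Equiv.symm_apply_apply, Equiv.symm_apply_apply]
  have hcard : (univ.image fun m : Fin p => (τ.σ ^ (m : ℕ)) i).card = p := by
    rw [card_image_of_injective _ (pow_apply_injective_prime hp hσ hi)]; simp
  have := card_le_card hsub
  rw [hcard, hcount] at this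
  omega

/-- **Lemma P7 (designs g5), kernel.** An array automorphism of an STD₂[12;6] with `σ⁷ = 1`, `ρ⁷ = 1` and `(β j)⁷ = 1` on
every fixed block class is the identity on points: no STD₂[12;6] admits an automorphism of order 7. -/
theorem no_order_seven (hπ : IsSTD 2 π) (hσ : τ.σ ^ 7 = 1) (hρ : τ.ρ ^ 7 = 1)
    (hβ : ∀ j, τ.ρ j = j → τ.β j ^ 7 = 1) : τ.σ = 1 ∧ ∀ i, τ.α i = 1 := by
  have hB := fixedCard_twelve_of_pow_seven hρ
  obtain ⟨j₁, j₂, hj, hj₁, hj₂⟩ := two_fixed_of_le (τ := τ.ρ) (by omega)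
  have hb₁ : τ.β j₁ = 1 := eq_one_of_pow_seven_six (hβ j₁ hj₁)
  have hb₂ : τ.β j₂ = 1 := eq_one_of_pow_seven_six (hβ j₂ hj₂)
  have hs : τ.σ = 1 := by
    by_contra hs
    have : ∃ i, τ.σ i ≠ i := by
      by_contra h
      push Not at h
      exact hs (Equiv.ext h)
    obtain ⟨i, hi⟩ := this
    exact no_identity_type_prime π τ hπ (by norm_num) (by norm_num) hσ hj hj₁ hj₂ hb₁ hb₂ hi
  refine ⟨hs, fun i => eq_one_of_fixedCard_eq _ ?_⟩
  have h := fixedCard_alpha_eq_beta π τ (i := i) (j := j₁) (by rw [hs]; rfl) hj₁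
  rw [h, hb₁]
  unfold fixedCard; simp

/-- Primes `p ≥ 13`: an array automorphism with `σᵖ = 1` and `(α i)ᵖ = 1` on fixed point classes is the identity on points
(it fixes every class, `12 < p`, and every label, `6 < p`). -/
theorem no_order_prime_ge_thirteen {p : ℕ} (hp : p.Prime) (h13 : 13 ≤ p) (hσ : τ.σ ^ p = 1)
    (hα : ∀ i, τ.σ i = i → τ.α i ^ p = 1) : τ.σ = 1 ∧ ∀ i, τ.α i = 1 := by
  haveI : Fact p.Prime := ⟨hp⟩
  have hs : τ.σ = 1 := by
    have h1 := fixedCard_modEq hσ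
    have h2 := fixedCard_le τ.σ
    simp only [Fintype.card_fin] at h1
    -- fixedCard ≡ 12 (mod p), fixedCard ≤ 12 < p ⇒ fixedCard = 12
    have h12 : fixedCard τ.σ = 12 := by
      have := Nat.ModEq.eq_of_lt_of_lt h1 (by omega) (by omega)
      omega
    exact eq_one_of_fixedCard_eq _ h12
  refine ⟨hs, fun i => ?_⟩
  have hfix : τ.σ i = i := by rw [hs]; rfl
  have h1 := fixedCard_modEq (hα i hfix)
  have h2 := fixedCard_le (τ.α i)
  simp only [Fintype.card_fin] at h1
  have h6 : fixedCard (τ.α i) = 6 := by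
    have := Nat.ModEq.eq_of_lt_of_lt h1 (by omega) (by omega)
    omega
  exact eq_one_of_fixedCard_eq _ h6

end STD

end Summit.Ventures.DiscreteObjects.STD
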